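import Summits.CriticalPhenomena.SAWScalingLimit.Theorems.SAWDefectDecoherenceBoundaryClosureRZigzagHalfLattice
import Literature.Analysis.FluidPDE.HarnackChainCover
import HarnessLib

/-!
# Crux `BoundaryClosureR` (stmt-CriticalPhenomena-14004), line `polygon-parity-squeeze`,
# stub `stub_innerPolygonsOfZigzag` (7b): tubes of faces and uniform thick chains

Landing target:
`Summits/CriticalPhenomena/SAWScalingLimit/Theorems/SAWDefectDecoherenceBoundaryClosureRZigzagDiscretisationTube.lean`
(`--supports stmt-CriticalPhenomena-14004`; building block of the registered stub
`stub_innerPolygonsOfZigzag`, the lattice half of the inner-polygon construction (IP)).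

Connectivity of the trimmed discretisation `Λ^P_δ` (and of its complement) is transported from the
connectivity of the polygon `P` (resp. of its exterior) in two steps, both provided here:

* `thick_uniform` — **uniform thick chains**: if `S ⊆ ℂ` is open, connected, `Sᶜ ≠ ∅`, and `K ⊆ S` is
  compact, there is `t > 0` such that any two points of `K` are joined by a chain of points with
  consecutive distances `≤ t`, all at distance `≥ 8t` from `Sᶜ` (compact connected envelope +
  `exists_uniform_chain` of `Literature.Analysis.FluidPDE`);
* `tube` — **tubes of faces**: two faces of `ℍ` whose centres are at distance `≤ R` are joined in the
  subgraph induced on any vertex set containing all faces with centre within `4R + 4` of the first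
  (an `L`-shaped lattice path in the two coordinate directions of `𝕋`);
* `exists_face_near` — every point of the plane is within distance `2` of the centre of an up face.

Sources: folklore.  No proposition is defined and no named fact is introduced.
-/

noncomputable section

open Set Metric
open Literature.Probability.LatticeModels
open Literature.Probability.Percolation (hexCenter_im hexCenter_re)

namespace Summit.CriticalPhenomena.SAWScalingLimit.Theorems.PolygonParitySqueeze.ZigzagDiscretisation

/-! ### 1. Uniform thick chains in an open connected set -/

/-- **Uniform thick chains.**  For `S` open connected with nonempty complement and `K ⊆ S` compact there
is `t > 0` such that any two points of `K` are joined by a chain `x = w 0, …, w n = y` with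
`dist (w i) (w (i+1)) ≤ t` and `8t ≤ infDist (w i) Sᶜ`. [folklore] -/
theorem thick_uniform {S K : Set ℂ} (hS : IsOpen S) (hSc : IsConnected S) (hSne : Sᶜ.Nonempty)
    (hK : IsCompact K) (hKS : K ⊆ S) :
    ∃ t : ℝ, 0 < t ∧ ∀ x ∈ K, ∀ y ∈ K, ∃ (n : ℕ) (w : ℕ → ℂ), w 0 = x ∧ w n = y ∧
      (∀ i < n, dist (w i) (w (i + 1)) ≤ t) ∧ (∀ i ≤ n, 8 * t ≤ infDist (w i) Sᶜ) := by
  rcases K.eq_empty_or_nonempty with rfl | hne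
  · exact ⟨1, one_pos, fun x hx => absurd hx (notMem_empty x)⟩
  obtain ⟨S', hS'c, hS'conn, hKS', hS'S⟩ :=
    Literature.Analysis.FluidPDE.exists_isCompact_isConnected_superset hS hSc hK hKS hne
  have hne' : S'.Nonempty := hne.mono hKS'
  obtain ⟨x₀, hx₀, hmin⟩ := hS'c.exists_isMinOn hne' (continuous_infDist_pt Sᶜ).continuousOn
  set τ : ℝ := infDist x₀ Sᶜ with hτ
  have hτpos : 0 < τ := (hS.isClosed_compl.notMem_iff_infDist_pos hSne).1 (fun h => h (hS'S hx₀))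
  obtain ⟨N, hN⟩ := Literature.Analysis.FluidPDE.exists_uniform_chain hS'c hS'conn.isPreconnected
    (R := τ / 8) (by positivity)
  refine ⟨τ / 8, by positivity, fun x hx y hy => ?_⟩
  obtain ⟨L, -, z, hz0, hzL, hzS, hzd⟩ := hN x (hKS' hx) y (hKS' hy)
  refine ⟨L, z, hz0, hzL, fun i hi => (hzd i hi).le, fun i hi => ?_⟩
  have := hmin (hzS i hi)
  rw [mem_setOf_eq] at this
  linarith

/-! ### 2. Faces near a point -/

/-- **Every point of the plane is within distance `2` of the centre of an up face** `(x; 0)`.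
[folklore] -/
theorem exists_face_near (y : ℂ) : ∃ x : Site 2, dist (hexCenter ((x, 0) : HexVertex)) y ≤ 2 := by
  have h3 : Real.sqrt 3 * Real.sqrt 3 = 3 := Real.mul_self_sqrt (by norm_num)
  have h3p : 0 < Real.sqrt 3 := Real.sqrt_pos.2 (by norm_num)
  set b : ℝ := y.im / (Real.sqrt 3 / 2) with hb
  set a : ℝ := y.re - b / 2 with ha
  refine ⟨![⌊a⌋, ⌊b⌋], ?_⟩
  have hbim : y.im = b * (Real.sqrt 3 / 2) := by rw [hb]; field_simp
  have hre : (hexCenter ((![⌊a⌋, ⌊b⌋], 0) : HexVertex)).re - y.re = (⌊a⌋ - a) + (⌊b⌋ - b) / 2 + 1 / 2 := by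
    rw [hexCenter_re]; simp [ha]; ring
  have him : (hexCenter ((![⌊a⌋, ⌊b⌋], 0) : HexVertex)).im - y.im = ((⌊b⌋ - b) + 1 / 3) * (Real.sqrt 3 / 2) := by
    rw [hexCenter_im, hbim]; simp; ring
  have h1 := Int.floor_le a
  have h2 := Int.lt_floor_add_one a
  have h4 := Int.floor_le b
  have h5 := Int.lt_floor_add_one b
  rw [dist_eq_norm]
  refine (Complex.norm_le_abs_re_add_abs_im _).trans ?_
  rw [Complex.sub_re, Complex.sub_im, hre, him]
  have e1 : |(⌊a⌋ - a) + (⌊b⌋ - b) / 2 + 1 / 2| ≤ 1 := by rw [abs_le]; constructor <;> linarith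
  have e2 : |((⌊b⌋ - b) + 1 / 3) * (Real.sqrt 3 / 2)| ≤ 1 := by
    rw [abs_le]; constructor <;> nlinarith
  linarith

/-! ### 3. Tubes of faces -/

/-- One step inside an induced subgraph of `ℍ`. [folklore] -/
theorem induce_reachable_of_adj {S : Set HexVertex} {a b : HexVertex} (ha : a ∈ S) (hb : b ∈ S)
    (h : hexGraph.Adj a b) : (hexGraph.induce S).Reachable ⟨a, ha⟩ ⟨b, hb⟩ :=
  SimpleGraph.Adj.reachable (show (hexGraph.induce S).Adj ⟨a, ha⟩ ⟨b, hb⟩ from h)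

/-- Changing the type of a face inside an induced subgraph (`(x;0) ∼ (x;1)`). [folklore] -/
theorem induce_reachable_type {S : Set HexVertex} (x : Site 2) (t t' : Fin 2) (h : (x, t) ∈ S) (h' : (x, t') ∈ S) :
    (hexGraph.induce S).Reachable ⟨(x, t), h⟩ ⟨(x, t'), h'⟩ := by
  by_cases htt : t = t'
  · subst htt; rfl
  · apply induce_reachable_of_adj
    fin_cases t <;> fin_cases t'
    · exact absurd rfl htt
    · exact (hexGraph_adj_iff_of_snd_eq_zero_holds x x).2 (Or.inl rfl)
    · exact (hexGraph_adj_iff_of_snd_eq_one x x).2 (Or.inl rfl)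
    · exact absurd rfl htt

/-- **Walking `n` cells in a positive coordinate direction** `u ∈ {e₀, e₁}`:
`(z;0) → (z;1) → (z+u;0) → ⋯ → (z+nu;0)` inside `S`. [folklore] -/
theorem induce_reachable_line_pos {S : Set HexVertex} (z u : Site 2) (hu : u = Pi.single 0 1 ∨ u = Pi.single 1 1)
    (n : ℕ) (hS : ∀ j : ℕ, j ≤ n → ∀ τ : Fin 2, (z + (j : ℤ) • u, τ) ∈ S)
    (h0 : (z, 0) ∈ S) (hn : (z + (n : ℤ) • u, 0) ∈ S) :
    (hexGraph.induce S).Reachable ⟨(z, 0), h0⟩ ⟨(z + (n : ℤ) • u, 0), hn⟩ := by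
  induction n with
  | zero =>
    have : (⟨(z, 0), h0⟩ : S) = ⟨(z + ((0 : ℕ) : ℤ) • u, 0), hn⟩ := by simp
    rw [this]
  | succ n ih =>
    have hS' : ∀ j : ℕ, j ≤ n → ∀ τ : Fin 2, (z + (j : ℤ) • u, τ) ∈ S := fun j hj τ => hS j (by omega) τ
    have hm0 : (z + (n : ℤ) • u, 0) ∈ S := hS n (by omega) 0
    have hm1 : (z + (n : ℤ) • u, 1) ∈ S := hS n (by omega) 1
    refine (ih hS' hm0).trans ((induce_reachable_type _ 0 1 hm0 hm1).trans (induce_reachable_of_adj hm1 hn ?_))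
    rw [hexGraph_adj_iff_of_snd_eq_one]
    rcases hu with rfl | rfl
    · right; left; push_cast; rw [add_smul, one_smul, add_assoc]
    · right; right; push_cast; rw [add_smul, one_smul, add_assoc]

/-- **Walking `n` cells in a negative coordinate direction** `u ∈ {e₀, e₁}`:
`(z;0) → (z-u;1) → (z-u;0) → ⋯ → (z-nu;0)` inside `S`. [folklore] -/
theorem induce_reachable_line_neg {S : Set HexVertex} (z u : Site 2) (hu : u = Pi.single 0 1 ∨ u = Pi.single 1 1)
    (n : ℕ) (hS : ∀ j : ℕ, j ≤ n → ∀ τ : Fin 2, (z - (j : ℤ) • u, τ) ∈ S)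
    (h0 : (z, 0) ∈ S) (hn : (z - (n : ℤ) • u, 0) ∈ S) :
    (hexGraph.induce S).Reachable ⟨(z, 0), h0⟩ ⟨(z - (n : ℤ) • u, 0), hn⟩ := by
  induction n with
  | zero =>
    have : (⟨(z, 0), h0⟩ : S) = ⟨(z - ((0 : ℕ) : ℤ) • u, 0), hn⟩ := by simp
    rw [this]
  | succ n ih =>
    have hS' : ∀ j : ℕ, j ≤ n → ∀ τ : Fin 2, (z - (j : ℤ) • u, τ) ∈ S := fun j hj τ => hS j (by omega) τ
    have hm0 : (z - (n : ℤ) • u, 0) ∈ S := hS n (by omega) 0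
    have hk1 : (z - ((n + 1 : ℕ) : ℤ) • u, 1) ∈ S := hS (n + 1) le_rfl 1
    refine (ih hS' hm0).trans ((induce_reachable_of_adj hm0 hk1 ?_).trans (induce_reachable_type _ 1 0 hk1 hn))
    rw [hexGraph_adj_iff_of_snd_eq_zero_holds]
    rcases hu with rfl | rfl
    · right; left; push_cast; rw [add_smul, one_smul, sub_add_eq_sub_sub]
    · right; right; push_cast; rw [add_smul, one_smul, sub_add_eq_sub_sub]

/-- **Walking `m : ℤ` cells in a coordinate direction** inside `S`, given all faces of the segment.
[folklore] -/
theorem induce_reachable_line {S : Set HexVertex} (z u : Site 2) (hu : u = Pi.single 0 1 ∨ u = Pi.single 1 1)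
    (m : ℤ) (hS : ∀ j : ℤ, min 0 m ≤ j → j ≤ max 0 m → ∀ τ : Fin 2, (z + j • u, τ) ∈ S)
    (h0 : (z, 0) ∈ S) (hm : (z + m • u, 0) ∈ S) :
    (hexGraph.induce S).Reachable ⟨(z, 0), h0⟩ ⟨(z + m • u, 0), hm⟩ := by
  rcases le_or_gt 0 m with hm0 | hm0
  · obtain ⟨n, rfl⟩ := Int.eq_ofNat_of_zero_le hm0
    exact induce_reachable_line_pos z u hu n
      (fun j hj τ => hS j (by simp) (by rw [le_max_iff]; right; exact_mod_cast hj) τ) h0 hm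
  · obtain ⟨n, hn⟩ := Int.exists_eq_neg_ofNat (le_of_lt hm0)
    subst hn
    have e : ∀ j : ℕ, z + (-(j : ℤ)) • u = z - (j : ℤ) • u := fun j => by rw [neg_smul, sub_eq_add_neg]
    have hm' : (z - (n : ℤ) • u, 0) ∈ S := by rw [← e]; exact hm
    have := induce_reachable_line_neg z u hu n (fun j hj τ => by
      rw [← e]; exact hS (-(j : ℤ)) (by rw [min_le_iff]; right; omega) (by simp) τ) h0 hm'
    convert this using 3; rw [e]

/-- **Distance of a translated face**: `dist (c (x + d; τ)) (c (x; t)) ≤ |d₀| + |d₁| + 1`. [folklore] -/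
theorem dist_hexCenter_translate_le (x d : Site 2) (t τ : Fin 2) :
    dist (hexCenter ((x + d, τ) : HexVertex)) (hexCenter ((x, t) : HexVertex)) ≤ |(d 0 : ℝ)| + |(d 1 : ℝ)| + 1 := by
  have h3 : Real.sqrt 3 * Real.sqrt 3 = 3 := Real.mul_self_sqrt (by norm_num)
  have key : hexCenter ((x + d, τ) : HexVertex) - hexCenter ((x, t) : HexVertex) =
      triEmbed d + ((((τ : ℕ) : ℝ) - ((t : ℕ) : ℝ) : ℝ) : ℂ) * ((1 + triZeta) / 3) := by
    simp only [hexCenter, triEmbed_add]; push_cast; ring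
  rw [dist_eq_norm, key]
  refine (norm_add_le _ _).trans ?_
  have h1 : ‖triEmbed d‖ ≤ |(d 0 : ℝ)| + |(d 1 : ℝ)| := by
    have hz : ‖triZeta‖ = 1 := by rw [triZeta, Complex.norm_exp]; simp
    calc ‖triEmbed d‖ = ‖((d 0 : ℝ) : ℂ) + ((d 1 : ℝ) : ℂ) * triZeta‖ := by simp [triEmbed]
      _ ≤ ‖((d 0 : ℝ) : ℂ)‖ + ‖((d 1 : ℝ) : ℂ) * triZeta‖ := norm_add_le _ _
      _ = |(d 0 : ℝ)| + |(d 1 : ℝ)| := by rw [norm_mul, hz, mul_one, Complex.norm_real, Complex.norm_real,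
          Real.norm_eq_abs, Real.norm_eq_abs]
  have h2 : ‖((((τ : ℕ) : ℝ) - ((t : ℕ) : ℝ) : ℝ) : ℂ) * ((1 + triZeta) / 3)‖ ≤ 1 := by
    rw [norm_mul, Complex.norm_real, Real.norm_eq_abs]
    have ha : |((τ : ℕ) : ℝ) - ((t : ℕ) : ℝ)| ≤ 1 := by
      fin_cases τ <;> fin_cases t <;> simp
    have hb : ‖(1 + triZeta) / 3‖ ≤ 1 := by
      rw [norm_div, Complex.norm_ofNat, div_le_one (by norm_num : (0:ℝ) < 3)]
      have : ‖(1 : ℂ) + triZeta‖ ^ 2 = 3 := by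
        rw [← Complex.normSq_eq_norm_sq, Complex.normSq_apply, triZeta_eq]; simp; nlinarith [h3]
      nlinarith [norm_nonneg ((1 : ℂ) + triZeta)]
    calc |((τ : ℕ) : ℝ) - ((t : ℕ) : ℝ)| * ‖(1 + triZeta) / 3‖ ≤ 1 * 1 := by gcongr
      _ = 1 := one_mul 1
  linarith

/-- **Coordinates are controlled by the distance of the centres**:
`|Δ₀| + |Δ₁| ≤ 3·dist + 2` for the cell difference `Δ` of two faces. [folklore] -/
theorem abs_add_abs_le_of_dist (x y : Site 2) (t t' : Fin 2) :
    |((y - x) 0 : ℝ)| + |((y - x) 1 : ℝ)| ≤ 3 * dist (hexCenter ((y, t') : HexVertex)) (hexCenter ((x, t) : HexVertex)) + 2 := by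
  have h3 : Real.sqrt 3 * Real.sqrt 3 = 3 := Real.mul_self_sqrt (by norm_num)
  have h3p : 0 < Real.sqrt 3 := Real.sqrt_pos.2 (by norm_num)
  set D := hexCenter ((y, t') : HexVertex) - hexCenter ((x, t) : HexVertex) with hD
  have hre : D.re = ((y - x) 0 : ℝ) + ((y - x) 1 : ℝ) / 2 + (((t' : ℕ) : ℝ) - ((t : ℕ) : ℝ)) / 2 := by
    rw [hD, Complex.sub_re, hexCenter_re, hexCenter_re]; push_cast [Pi.sub_apply]; ring
  have him : D.im = (((y - x) 1 : ℝ) + (((t' : ℕ) : ℝ) - ((t : ℕ) : ℝ)) / 3) * (Real.sqrt 3 / 2) := by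
    rw [hD, Complex.sub_im, hexCenter_im, hexCenter_im]; push_cast [Pi.sub_apply]; ring
  have hτ : |((t' : ℕ) : ℝ) - ((t : ℕ) : ℝ)| ≤ 1 := by fin_cases t <;> fin_cases t' <;> simp
  have hn : |D.re| ≤ dist (hexCenter ((y, t') : HexVertex)) (hexCenter ((x, t) : HexVertex)) ∧
      |D.im| ≤ dist (hexCenter ((y, t') : HexVertex)) (hexCenter ((x, t) : HexVertex)) := by
    rw [dist_eq_norm, ← hD]; exact ⟨Complex.abs_re_le_norm D, Complex.abs_im_le_norm D⟩
  obtain ⟨h1, h2⟩ := hn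
  rw [hre] at h1
  rw [him] at h2
  set A : ℝ := ((y - x) 0 : ℝ)
  set B : ℝ := ((y - x) 1 : ℝ)
  set T : ℝ := ((t' : ℕ) : ℝ) - ((t : ℕ) : ℝ)
  set d := dist (hexCenter ((y, t') : HexVertex)) (hexCenter ((x, t) : HexVertex))
  have hs : (17 : ℝ) / 20 < Real.sqrt 3 / 2 := by nlinarith
  -- `|B| ≤ (20/17)(d) + 1/3`
  have hB : |B + T / 3| * (Real.sqrt 3 / 2) ≤ d := by
    rwa [abs_mul, abs_of_pos (by positivity : (0:ℝ) < Real.sqrt 3 / 2)] at h2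
  have hB' : |B| ≤ 20 / 17 * d + 1 / 3 := by
    have := abs_add_le B (T / 3)  -- not directly; use |B| ≤ |B + T/3| + |T/3|
    have e1 : |B| ≤ |B + T / 3| + |T / 3| := by
      calc |B| = |(B + T / 3) + (-(T / 3))| := by ring_nf
        _ ≤ |B + T / 3| + |-(T / 3)| := abs_add_le _ _
        _ = |B + T / 3| + |T / 3| := by rw [abs_neg]
    have e2 : |T / 3| ≤ 1 / 3 := by rw [abs_div, abs_of_pos (by norm_num : (0:ℝ) < 3)]; linarith
    have e3 : |B + T / 3| ≤ 20 / 17 * d := by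
      have hd : 0 ≤ d := dist_nonneg
      by_contra hc
      push Not at hc
      have : 20 / 17 * d * (17 / 20) < |B + T / 3| * (Real.sqrt 3 / 2) := by
        have h0 : 0 ≤ 20 / 17 * d := by positivity
        calc 20 / 17 * d * (17 / 20) ≤ 20 / 17 * d * (Real.sqrt 3 / 2) := by gcongr
          _ < |B + T / 3| * (Real.sqrt 3 / 2) := by gcongr
      linarith
    linarith
  have hA : |A| ≤ d + |B| / 2 + 1 / 2 := by
    have e1 : |A| ≤ |A + B / 2 + T / 2| + |B / 2| + |T / 2| := by
      calc |A| = |(A + B / 2 + T / 2) + (-(B / 2)) + (-(T / 2))| := by ring_nf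
        _ ≤ |(A + B / 2 + T / 2) + (-(B / 2))| + |-(T / 2)| := abs_add_le _ _
        _ ≤ |A + B / 2 + T / 2| + |-(B / 2)| + |-(T / 2)| := by gcongr; exact abs_add_le _ _
        _ = _ := by rw [abs_neg, abs_neg]
    have e2 : |T / 2| ≤ 1 / 2 := by rw [abs_div, abs_of_pos (by norm_num : (0:ℝ) < 2)]; linarith
    have e3 : |B / 2| = |B| / 2 := by rw [abs_div, abs_of_pos (by norm_num : (0:ℝ) < 2)]
    linarith
  have hd : 0 ≤ d := dist_nonneg
  nlinarith

/-- Decomposition of a cell difference along the two coordinate directions. [folklore] -/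
theorem site_eq_add_smul (x y : Site 2) :
    y = x + (y - x) 0 • (Pi.single 0 1 : Site 2) + (y - x) 1 • (Pi.single 1 1 : Site 2) := by
  ext i
  fin_cases i <;> simp

/-- **Tubes of faces.**  Two faces whose centres are at distance `≤ R` are joined in the subgraph of
`ℍ` induced on any vertex set containing every face with centre within `4R + 4` of the first one.
[folklore] -/
theorem tube (S : Set HexVertex) (v w : HexVertex) (R : ℝ) (hR : dist (hexCenter v) (hexCenter w) ≤ R)
    (hS : ∀ u : HexVertex, dist (hexCenter u) (hexCenter v) ≤ 4 * R + 4 → u ∈ S) :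
    ∃ (hv : v ∈ S) (hw : w ∈ S), (hexGraph.induce S).Reachable ⟨v, hv⟩ ⟨w, hw⟩ := by
  obtain ⟨x, t⟩ := v
  obtain ⟨y, t'⟩ := w
  set A : ℤ := (y - x) 0 with hA
  set B : ℤ := (y - x) 1 with hB
  have hAB : |(A : ℝ)| + |(B : ℝ)| ≤ 3 * R + 2 := by
    have := abs_add_abs_le_of_dist x y t t'
    rw [dist_comm] at hR
    have h' : |((y - x) 0 : ℝ)| + |((y - x) 1 : ℝ)| ≤ 3 * R + 2 := by nlinarith
    simpa [hA, hB] using h'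
  have hR0 : 0 ≤ R := dist_nonneg.trans hR
  -- every face of the box is in `S`
  have box : ∀ d : Site 2, |(d 0 : ℝ)| ≤ |(A : ℝ)| → |(d 1 : ℝ)| ≤ |(B : ℝ)| → ∀ τ : Fin 2, ((x + d, τ) : HexVertex) ∈ S := by
    intro d h0 h1 τ
    apply hS
    refine (dist_hexCenter_translate_le x d t τ).trans ?_
    linarith
  have hx0 : ((x, 0) : HexVertex) ∈ S := by
    have := box 0 (by simp) (by simp) 0; simpa using this
  have hxt : ((x, t) : HexVertex) ∈ S := by
    have := box 0 (by simp) (by simp) t; simpa using this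
  -- first leg: along `e₀`
  set z₁ : Site 2 := x + A • (Pi.single 0 1 : Site 2) with hz₁
  have hleg1 : ∀ j : ℤ, min 0 A ≤ j → j ≤ max 0 A → ∀ τ : Fin 2, ((x + j • (Pi.single 0 1 : Site 2), τ) : HexVertex) ∈ S := by
    intro j hj1 hj2 τ
    apply box
    · have : |(j : ℝ)| ≤ |(A : ℝ)| := by
        rw [abs_le]; constructor
        · have : (min 0 A : ℝ) ≤ j := by exact_mod_cast hj1
          have h' : -|(A:ℝ)| ≤ min 0 (A : ℝ) := by
            rw [le_min_iff]; exact ⟨by simp, neg_abs_le _⟩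
          linarith
        · have : (j : ℝ) ≤ max 0 A := by exact_mod_cast hj2
          have h' : max 0 (A : ℝ) ≤ |(A:ℝ)| := max_le (abs_nonneg _) (le_abs_self _)
          push_cast at this; linarith
      simpa [Pi.single_apply] using this
    · simp
  have hz₁0 : ((z₁, 0) : HexVertex) ∈ S := hleg1 A (min_le_right _ _) (le_max_right _ _) 0
  have r1 : (hexGraph.induce S).Reachable ⟨(x, 0), hx0⟩ ⟨(z₁, 0), hz₁0⟩ :=
    induce_reachable_line x _ (Or.inl rfl) A hleg1 hx0 hz₁0
  -- second leg: along `e₁`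
  have hleg2 : ∀ j : ℤ, min 0 B ≤ j → j ≤ max 0 B → ∀ τ : Fin 2, ((z₁ + j • (Pi.single 1 1 : Site 2), τ) : HexVertex) ∈ S := by
    intro j hj1 hj2 τ
    rw [hz₁, add_assoc]
    apply box
    · simp
    · have : |(j : ℝ)| ≤ |(B : ℝ)| := by
        rw [abs_le]; constructor
        · have : (min 0 B : ℝ) ≤ j := by exact_mod_cast hj1
          have h' : -|(B:ℝ)| ≤ min 0 (B : ℝ) := by
            rw [le_min_iff]; exact ⟨by simp, neg_abs_le _⟩
          linarith
        · have : (j : ℝ) ≤ max 0 B := by exact_mod_cast hj2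
          have h' : max 0 (B : ℝ) ≤ |(B:ℝ)| := max_le (abs_nonneg _) (le_abs_self _)
          push_cast at this; linarith
      simpa [Pi.single_apply] using this
  have hy : y = z₁ + B • (Pi.single 1 1 : Site 2) := by rw [hz₁, hA, hB]; exact site_eq_add_smul x y
  have hy0 : ((z₁ + B • (Pi.single 1 1 : Site 2), 0) : HexVertex) ∈ S := hleg2 B (min_le_right _ _) (le_max_right _ _) 0
  have r2 : (hexGraph.induce S).Reachable ⟨(z₁, 0), hz₁0⟩ ⟨(z₁ + B • (Pi.single 1 1 : Site 2), 0), hy0⟩ :=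
    induce_reachable_line z₁ _ (Or.inr rfl) B hleg2 hz₁0 hy0
  have hy0' : ((y, 0) : HexVertex) ∈ S := by rw [hy]; exact hy0
  have hyt : ((y, t') : HexVertex) ∈ S := by rw [hy]; exact hleg2 B (min_le_right _ _) (le_max_right _ _) t'
  refine ⟨hxt, hyt, ?_⟩
  have r3 : (hexGraph.induce S).Reachable ⟨(z₁ + B • (Pi.single 1 1 : Site 2), 0), hy0⟩ ⟨(y, t'), hyt⟩ := by
    have e : (⟨(z₁ + B • (Pi.single 1 1 : Site 2), 0), hy0⟩ : S) = ⟨(y, 0), hy0'⟩ := by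
      simp only [Subtype.mk.injEq, Prod.mk.injEq, and_true]; exact hy.symm
    rw [e]
    exact induce_reachable_type y 0 t' hy0' hyt
  exact (induce_reachable_type x t 0 hxt hx0).trans (r1.trans (r2.trans r3))

/-- **Tubes of faces** (registered form, sub-goal of `stub_innerPolygonsOfZigzag`). [folklore] -/
theorem zd_tube : ∀ (S : Set HexVertex) (v w : HexVertex) (R : ℝ), dist (hexCenter v) (hexCenter w) ≤ R → (∀ u : HexVertex, dist (hexCenter u) (hexCenter v) ≤ 4 * R + 4 → u ∈ S) → ∃ (hv : v ∈ S) (hw : w ∈ S), (hexGraph.induce S).Reachable ⟨v, hv⟩ ⟨w, hw⟩ := tube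

end Summit.CriticalPhenomena.SAWScalingLimit.Theorems.PolygonParitySqueeze.ZigzagDiscretisation

end
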